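import Literature.Probability.Distributions.BrascampLiebCalculus
import HarnessLib

/-!
# The confining potential `ψ_S(x) = (∑ xᵢ² - S²)₊³` for the Brascamp–Lieb approximation

`Literature/Probability/Distributions/`. In the last step of the proof of Brascamp–Lieb 1976,
Theorem 4.1 (p. 379), the potential `f` is modified outside a ball of radius `S` by adding
`N (|x| - S)⁴` and `N → ∞` restricts the measure to the ball. We use the `C²` confining term

  `ψ_S(x) = ρ(∑ᵢ xᵢ² - S²)`,  `ρ(t) = (max t 0)³`,

which vanishes together with its first and second derivatives on the Euclidean ball
`{∑ xᵢ² ≤ S²}`, has positive semidefinite Hessian everywhere, Hessian `≥ 6(2S+1)²·‖v‖²` where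
`‖x‖_∞ ≥ S + 1`, grows at least linearly, and has polynomially bounded first and second
derivatives (so that `χ f + N ψ_S` is a tame potential). This file: the calculus of `ρ` and `ψ_S`
(derivatives computed along lines).

Theorems only. References: H. J. Brascamp, E. H. Lieb, J. Funct. Anal. 22 (1976) 366–389,
Thm 4.1 (proof, p. 379, the functions `f^{(N)}`). [BrascampLieb1976]
-/

noncomputable section

open Filter Set Asymptotics Finset
open scoped Topology BigOperators

namespace Literature.Probability.Distributions

namespace BrascampLiebCutoff

open BrascampLiebCalculus

/-! ### The function `ρ(t) = (t₊)ⁿ` -/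

section Rho

/-- `|max h 0 ^ n| ≤ |h ^ n|`. [folklore] -/
theorem abs_posPart_pow_le (h : ℝ) (n : ℕ) : |max h 0 ^ n| ≤ |h ^ n| := by
  rw [abs_pow, abs_pow, abs_of_nonneg (le_max_right _ _)]
  exact pow_le_pow_left₀ (le_max_right _ _) (max_le (le_abs_self h) (abs_nonneg h)) n

/-- `t ↦ (max t 0)ⁿ` is differentiable for `n ≥ 2`, with derivative `n (max t 0)ⁿ⁻¹`. [folklore] -/
theorem hasDerivAt_posPart_pow {n : ℕ} (hn : 2 ≤ n) (t : ℝ) :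
    HasDerivAt (fun t : ℝ => max t 0 ^ n) (n * max t 0 ^ (n - 1)) t := by
  rcases lt_trichotomy t 0 with ht | rfl | ht
  · -- locally zero
    have hev : (fun s : ℝ => max s 0 ^ n) =ᶠ[𝓝 t] fun _ => 0 := by
      filter_upwards [Iio_mem_nhds ht] with s hs
      rw [max_eq_right (le_of_lt hs), zero_pow (by omega)]
    rw [max_eq_right ht.le, zero_pow (by omega), mul_zero]
    exact (hasDerivAt_const t (0 : ℝ)).congr_of_eventuallyEq hev
  · -- at zero: `(max h 0)ⁿ = o(h)`
    rw [max_self, zero_pow (by omega), mul_zero, hasDerivAt_iff_isLittleO_nhds_zero]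
    simp only [zero_add, max_self, zero_pow (show n ≠ 0 by omega), sub_zero, smul_zero]
    have h1 : (fun h : ℝ => max h 0 ^ n) =O[𝓝 0] fun h => h ^ n :=
      IsBigO.of_bound 1 (Eventually.of_forall fun h => by
        simpa using abs_posPart_pow_le h n)
    exact h1.trans_isLittleO (isLittleO_pow_id (by omega))
  · -- locally `tⁿ`
    have hev : (fun s : ℝ => max s 0 ^ n) =ᶠ[𝓝 t] fun s => s ^ n := by
      filter_upwards [Ioi_mem_nhds ht] with s hs
      rw [max_eq_left (le_of_lt hs)]
    rw [max_eq_left ht.le]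
    exact (hasDerivAt_pow n t).congr_of_eventuallyEq hev

/-- `ρ(t) = (max t 0)³` has derivative `3 (max t 0)²`. [folklore] -/
theorem hasDerivAt_rho (t : ℝ) : HasDerivAt (fun t : ℝ => max t 0 ^ 3) (3 * max t 0 ^ 2) t := by
  simpa using hasDerivAt_posPart_pow (n := 3) (by norm_num) t

/-- `ρ'(t) = 3 (max t 0)²` has derivative `6 max t 0`. [folklore] -/
theorem hasDerivAt_rho' (t : ℝ) : HasDerivAt (fun t : ℝ => 3 * max t 0 ^ 2) (6 * max t 0) t := by
  have := (hasDerivAt_posPart_pow (n := 2) le_rfl t).const_mul 3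
  simp only [Nat.cast_ofNat, pow_one, Nat.reduceSub] at this
  refine this.congr_deriv ?_
  ring

/-- `ρ(t) = (max t 0)³` is `C²`. [folklore] -/
theorem contDiff_rho : ContDiff ℝ 2 (fun t : ℝ => max t 0 ^ 3) := by
  have e1 : deriv (fun t : ℝ => max t 0 ^ 3) = fun t => 3 * max t 0 ^ 2 :=
    funext fun t => (hasDerivAt_rho t).deriv
  have e2 : deriv (fun t : ℝ => 3 * max t 0 ^ 2) = fun t => 6 * max t 0 :=
    funext fun t => (hasDerivAt_rho' t).deriv
  rw [show (2 : WithTop ℕ∞) = 1 + 1 by norm_num, contDiff_succ_iff_deriv]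
  refine ⟨fun t => (hasDerivAt_rho t).differentiableAt, by simp, ?_⟩
  rw [e1, show (1 : WithTop ℕ∞) = 0 + 1 by norm_num, contDiff_succ_iff_deriv]
  refine ⟨fun t => (hasDerivAt_rho' t).differentiableAt, by simp, ?_⟩
  rw [e2]
  exact contDiff_zero.2 (by fun_prop)

/-- `ρ'(t) = 3(max t 0)²` is `C¹`. [folklore] -/
theorem contDiff_rho' : ContDiff ℝ 1 (fun t : ℝ => 3 * max t 0 ^ 2) := by
  have e2 : deriv (fun t : ℝ => 3 * max t 0 ^ 2) = fun t => 6 * max t 0 :=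
    funext fun t => (hasDerivAt_rho' t).deriv
  rw [show (1 : WithTop ℕ∞) = 0 + 1 by norm_num, contDiff_succ_iff_deriv]
  refine ⟨fun t => (hasDerivAt_rho' t).differentiableAt, by simp, ?_⟩
  rw [e2]
  exact contDiff_zero.2 (by fun_prop)

end Rho

/-! ### The quadratic form `q(x) = ∑ xᵢ² - S²` along lines, and sup-norm comparisons -/

section Quad

variable {m : ℕ}

/-- Derivative of `s ↦ ∑ (xᵢ + s vᵢ)² - S²`. [folklore] -/
theorem hasDerivAt_quad_line (x v : Fin m → ℝ) (S s : ℝ) :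
    HasDerivAt (fun s : ℝ => (∑ i, (x i + s * v i) ^ 2) - S ^ 2)
      (∑ i, 2 * (x i + s * v i) * v i) s := by
  have h : ∀ i ∈ (univ : Finset (Fin m)), HasDerivAt (fun s : ℝ => (x i + s * v i) ^ 2)
      (2 * (x i + s * v i) * v i) s := by
    intro i _
    have h1 : HasDerivAt (fun s : ℝ => x i + s * v i) (v i) s := by
      simpa using ((hasDerivAt_id s).mul_const (v i)).const_add (x i)
    have := h1.fun_pow 2
    refine this.congr_deriv ?_
    norm_num
  exact (HasDerivAt.fun_sum h).sub_const (S ^ 2)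

/-- `(x + s v)ᵢ = xᵢ + s vᵢ` under the quadratic form. [folklore] -/
theorem quad_line_eq (x v : Fin m → ℝ) (S s : ℝ) :
    (∑ i, ((x + s • v) i) ^ 2) - S ^ 2 = (∑ i, (x i + s * v i) ^ 2) - S ^ 2 := by
  simp [Pi.add_apply, Pi.smul_apply, smul_eq_mul]

/-- `∑ xᵢ² ≤ m ‖x‖²` (sup norm). [folklore] -/
theorem sum_sq_le (x : Fin m → ℝ) : ∑ i, x i ^ 2 ≤ m * ‖x‖ ^ 2 := by
  calc ∑ i, x i ^ 2 ≤ ∑ _i : Fin m, ‖x‖ ^ 2 := by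
        refine sum_le_sum fun i _ => ?_
        have h := norm_le_pi_norm x i
        rw [Real.norm_eq_abs] at h
        calc x i ^ 2 = |x i| ^ 2 := (sq_abs _).symm
          _ ≤ ‖x‖ ^ 2 := pow_le_pow_left₀ (abs_nonneg _) h 2
    _ = m * ‖x‖ ^ 2 := by simp

/-- `‖x‖² ≤ ∑ xᵢ²` (sup norm). [folklore] -/
theorem norm_sq_le_sum_sq (x : Fin m → ℝ) : ‖x‖ ^ 2 ≤ ∑ i, x i ^ 2 := by
  have h0 : 0 ≤ ∑ i, x i ^ 2 := sum_nonneg fun i _ => sq_nonneg _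
  have h1 : ‖x‖ ≤ Real.sqrt (∑ i, x i ^ 2) := by
    refine (pi_norm_le_iff_of_nonneg (Real.sqrt_nonneg _)).2 fun j => ?_
    rw [Real.norm_eq_abs]
    exact Real.abs_le_sqrt (single_le_sum (f := fun i => x i ^ 2) (fun i _ => sq_nonneg _) (mem_univ j))
  calc ‖x‖ ^ 2 ≤ Real.sqrt (∑ i, x i ^ 2) ^ 2 := pow_le_pow_left₀ (norm_nonneg _) h1 2
    _ = ∑ i, x i ^ 2 := Real.sq_sqrt h0

/-- `|∑ xᵢ vᵢ| ≤ m ‖x‖ ‖v‖` (sup norms). [folklore] -/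
theorem abs_sum_mul_le (x v : Fin m → ℝ) : |∑ i, x i * v i| ≤ m * ‖x‖ * ‖v‖ := by
  calc |∑ i, x i * v i| ≤ ∑ i, |x i * v i| := abs_sum_le_sum_abs _ _
    _ ≤ ∑ _i : Fin m, ‖x‖ * ‖v‖ := by
        refine sum_le_sum fun i _ => ?_
        rw [abs_mul]
        have h1 := norm_le_pi_norm x i
        have h2 := norm_le_pi_norm v i
        rw [Real.norm_eq_abs] at h1 h2
        exact mul_le_mul h1 h2 (abs_nonneg _) (norm_nonneg _)
    _ = m * ‖x‖ * ‖v‖ := by simp [mul_assoc]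

end Quad

/-! ### The confining potential `ψ_S` -/

section Psi

variable {m : ℕ} (S : ℝ)

/-- `ψ_S` is `C²`. [folklore] -/
theorem contDiff_psi : ContDiff ℝ 2 (fun x : Fin m → ℝ => max ((∑ i, x i ^ 2) - S ^ 2) 0 ^ 3) := by
  have hq : ContDiff ℝ 2 (fun x : Fin m → ℝ => (∑ i, x i ^ 2) - S ^ 2) :=
    (ContDiff.sum fun i _ => (contDiff_apply ℝ ℝ i).pow 2).sub contDiff_const
  exact contDiff_rho.comp hq

/-- `ψ_S` along a line: `(d/ds) ψ_S(x + s v) = 3 q₊(x+sv)² · ∑ 2(xᵢ + s vᵢ) vᵢ`. [folklore] -/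
theorem hasDerivAt_psi_line (x v : Fin m → ℝ) (s : ℝ) :
    HasDerivAt (fun s : ℝ => max ((∑ i, ((x + s • v) i) ^ 2) - S ^ 2) 0 ^ 3)
      (3 * max ((∑ i, (x i + s * v i) ^ 2) - S ^ 2) 0 ^ 2 * ∑ i, 2 * (x i + s * v i) * v i) s := by
  simp_rw [quad_line_eq]
  exact (hasDerivAt_rho _).comp s (hasDerivAt_quad_line x v S s)

/-- **First derivative of `ψ_S`**: `Dψ_S(x) v = 3 q₊(x)² · 2∑ xᵢ vᵢ`. [folklore] -/
theorem fderiv_psi_apply (x v : Fin m → ℝ) :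
    fderiv ℝ (fun x : Fin m → ℝ => max ((∑ i, x i ^ 2) - S ^ 2) 0 ^ 3) x v =
      3 * max ((∑ i, x i ^ 2) - S ^ 2) 0 ^ 2 * ∑ i, 2 * x i * v i := by
  have hd : Differentiable ℝ (fun x : Fin m → ℝ => max ((∑ i, x i ^ 2) - S ^ 2) 0 ^ 3) :=
    (contDiff_psi S).differentiable two_ne_zero
  have h1 := hasDerivAt_line hd x v 0
  have h2 := hasDerivAt_psi_line S x v 0
  simp only [zero_smul, add_zero, zero_mul] at h1 h2
  exact h1.unique h2

/-- The first derivative `x ↦ Dψ_S(x) v` is `C¹`. [folklore] -/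
theorem contDiff_fderiv_psi_apply (v : Fin m → ℝ) :
    ContDiff ℝ 1 (fun x : Fin m → ℝ =>
      fderiv ℝ (fun x : Fin m → ℝ => max ((∑ i, x i ^ 2) - S ^ 2) 0 ^ 3) x v) := by
  have e : (fun x : Fin m → ℝ => fderiv ℝ (fun x : Fin m → ℝ => max ((∑ i, x i ^ 2) - S ^ 2) 0 ^ 3) x v)
      = fun x => 3 * max ((∑ i, x i ^ 2) - S ^ 2) 0 ^ 2 * ∑ i, 2 * x i * v i :=
    funext fun x => fderiv_psi_apply S x v
  rw [e]
  have hq : ContDiff ℝ 1 (fun x : Fin m → ℝ => (∑ i, x i ^ 2) - S ^ 2) :=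
    (ContDiff.sum fun i _ => (contDiff_apply ℝ ℝ i).pow 2).sub contDiff_const
  have hl : ContDiff ℝ 1 (fun x : Fin m → ℝ => ∑ i, 2 * x i * v i) :=
    ContDiff.sum fun i _ => (contDiff_const.mul (contDiff_apply ℝ ℝ i)).mul contDiff_const
  exact (contDiff_rho'.comp hq).mul hl

/-- **Second derivative of `ψ_S`** along `(w, v)`:
`D(x ↦ Dψ_S(x)v)(x) w = 6 q₊(x) (2∑xᵢwᵢ)(2∑xᵢvᵢ) + 3 q₊(x)² · 2∑ wᵢvᵢ`. [folklore] -/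
theorem fderiv_fderiv_psi_apply (x v w : Fin m → ℝ) :
    fderiv ℝ (fun x : Fin m → ℝ =>
        fderiv ℝ (fun x : Fin m → ℝ => max ((∑ i, x i ^ 2) - S ^ 2) 0 ^ 3) x v) x w =
      6 * max ((∑ i, x i ^ 2) - S ^ 2) 0 * (∑ i, 2 * x i * w i) * (∑ i, 2 * x i * v i) +
        3 * max ((∑ i, x i ^ 2) - S ^ 2) 0 ^ 2 * ∑ i, 2 * w i * v i := by
  have e : (fun x : Fin m → ℝ => fderiv ℝ (fun x : Fin m → ℝ => max ((∑ i, x i ^ 2) - S ^ 2) 0 ^ 3) x v)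
      = fun x => 3 * max ((∑ i, x i ^ 2) - S ^ 2) 0 ^ 2 * ∑ i, 2 * x i * v i :=
    funext fun x => fderiv_psi_apply S x v
  rw [e]
  have hd : Differentiable ℝ (fun x : Fin m → ℝ => 3 * max ((∑ i, x i ^ 2) - S ^ 2) 0 ^ 2 * ∑ i, 2 * x i * v i) := by
    have := (contDiff_fderiv_psi_apply S v).differentiable one_ne_zero
    rwa [e] at this
  have h1 := hasDerivAt_line hd x w 0
  -- the same line derivative computed by hand
  have hA : HasDerivAt (fun s : ℝ => 3 * max ((∑ i, (x i + s * w i) ^ 2) - S ^ 2) 0 ^ 2)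
      (6 * max ((∑ i, (x i + 0 * w i) ^ 2) - S ^ 2) 0 * ∑ i, 2 * (x i + 0 * w i) * w i) 0 :=
    (hasDerivAt_rho' _).comp 0 (hasDerivAt_quad_line x w S 0)
  have hB : HasDerivAt (fun s : ℝ => ∑ i, 2 * (x i + s * w i) * v i) (∑ i, 2 * w i * v i) 0 := by
    have h : ∀ i ∈ (univ : Finset (Fin m)), HasDerivAt (fun s : ℝ => 2 * (x i + s * w i) * v i)
        (2 * w i * v i) 0 := by
      intro i _
      have h1 : HasDerivAt (fun s : ℝ => x i + s * w i) (w i) 0 := by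
        simpa using ((hasDerivAt_id (0 : ℝ)).mul_const (w i)).const_add (x i)
      have := (h1.const_mul 2).mul_const (v i)
      simpa using this
    exact HasDerivAt.fun_sum h
  have h2 := hA.mul hB
  have e2 : (fun s : ℝ => 3 * max ((∑ i, ((x + s • w) i) ^ 2) - S ^ 2) 0 ^ 2 * ∑ i, 2 * (x + s • w) i * v i)
      = fun s => 3 * max ((∑ i, (x i + s * w i) ^ 2) - S ^ 2) 0 ^ 2 * ∑ i, 2 * (x i + s * w i) * v i := by
    funext s
    simp [Pi.add_apply, Pi.smul_apply, smul_eq_mul]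
  rw [e2] at h1
  have := h1.unique h2
  simpa using this

/-- Polynomial bound for `Dψ_S`: `|Dψ_S(x)v| ≤ 6m³ (1+‖x‖)⁵ ‖v‖`. [folklore] -/
theorem fderiv_psi_bound (x v : Fin m → ℝ) :
    |fderiv ℝ (fun x : Fin m → ℝ => max ((∑ i, x i ^ 2) - S ^ 2) 0 ^ 3) x v| ≤
      6 * (m : ℝ) ^ 3 * (1 + ‖x‖) ^ 5 * ‖v‖ := by
  rw [fderiv_psi_apply]
  have hq : max ((∑ i, x i ^ 2) - S ^ 2) 0 ≤ m * ‖x‖ ^ 2 :=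
    max_le (by linarith [sum_sq_le x, sq_nonneg S]) (by positivity)
  have hq0 : 0 ≤ max ((∑ i, x i ^ 2) - S ^ 2) 0 := le_max_right _ _
  have hl : |∑ i, 2 * x i * v i| ≤ 2 * (m * ‖x‖ * ‖v‖) := by
    have : ∑ i, 2 * x i * v i = 2 * ∑ i, x i * v i := by
      rw [mul_sum]; exact sum_congr rfl fun i _ => by ring
    rw [this, abs_mul, abs_two]
    exact mul_le_mul_of_nonneg_left (abs_sum_mul_le x v) zero_le_two
  rw [abs_mul, abs_mul, abs_of_nonneg (by positivity : (0 : ℝ) ≤ 3), abs_of_nonneg (pow_nonneg hq0 2)]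
  have hx1 : ‖x‖ ≤ 1 + ‖x‖ := by linarith
  have hx0 := norm_nonneg x
  have hv0 := norm_nonneg v
  calc 3 * max ((∑ i, x i ^ 2) - S ^ 2) 0 ^ 2 * |∑ i, 2 * x i * v i|
      ≤ 3 * (m * ‖x‖ ^ 2) ^ 2 * (2 * (m * ‖x‖ * ‖v‖)) := by gcongr
    _ = 6 * (m : ℝ) ^ 3 * (‖x‖ ^ 4 * ‖x‖) * ‖v‖ := by ring
    _ ≤ 6 * (m : ℝ) ^ 3 * ((1 + ‖x‖) ^ 4 * (1 + ‖x‖)) * ‖v‖ := by gcongr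
    _ = 6 * (m : ℝ) ^ 3 * (1 + ‖x‖) ^ 5 * ‖v‖ := by ring

/-- Polynomial bound for `D²ψ_S`: `|D(Dψ_S · v)(x) w| ≤ 30 m³ (1+‖x‖)⁵ ‖v‖ ‖w‖`. [folklore] -/
theorem fderiv_fderiv_psi_bound (x v w : Fin m → ℝ) :
    |fderiv ℝ (fun x : Fin m → ℝ =>
        fderiv ℝ (fun x : Fin m → ℝ => max ((∑ i, x i ^ 2) - S ^ 2) 0 ^ 3) x v) x w| ≤
      30 * (m : ℝ) ^ 3 * (1 + ‖x‖) ^ 5 * ‖v‖ * ‖w‖ := by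
  rw [fderiv_fderiv_psi_apply]
  have hq : max ((∑ i, x i ^ 2) - S ^ 2) 0 ≤ m * ‖x‖ ^ 2 :=
    max_le (by linarith [sum_sq_le x, sq_nonneg S]) (by positivity)
  have hq0 : 0 ≤ max ((∑ i, x i ^ 2) - S ^ 2) 0 := le_max_right _ _
  have hsum : ∀ a b : Fin m → ℝ, |∑ i, 2 * a i * b i| ≤ 2 * (m * ‖a‖ * ‖b‖) := fun a b => by
    have : ∑ i, 2 * a i * b i = 2 * ∑ i, a i * b i := by
      rw [mul_sum]; exact sum_congr rfl fun i _ => by ring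
    rw [this, abs_mul, abs_two]
    exact mul_le_mul_of_nonneg_left (abs_sum_mul_le a b) zero_le_two
  have hx1 : ‖x‖ ≤ 1 + ‖x‖ := by linarith
  have hx0 := norm_nonneg x
  have hv0 := norm_nonneg v
  have hw0 := norm_nonneg w
  have h1le : 1 ≤ 1 + ‖x‖ := by linarith
  set M := max ((∑ i, x i ^ 2) - S ^ 2) 0 with hM
  have b1 : |6 * M * (∑ i, 2 * x i * w i) * (∑ i, 2 * x i * v i)| ≤
      6 * (m * ‖x‖ ^ 2) * (2 * (m * ‖x‖ * ‖w‖)) * (2 * (m * ‖x‖ * ‖v‖)) := by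
    rw [abs_mul, abs_mul, abs_mul, abs_of_nonneg (by norm_num : (0 : ℝ) ≤ 6), abs_of_nonneg hq0]
    gcongr
    · exact hsum x w
    · exact hsum x v
  have b2 : |3 * M ^ 2 * ∑ i, 2 * w i * v i| ≤ 3 * (m * ‖x‖ ^ 2) ^ 2 * (2 * (m * ‖w‖ * ‖v‖)) := by
    rw [abs_mul, abs_mul, abs_pow, abs_of_nonneg (by norm_num : (0 : ℝ) ≤ 3), abs_of_nonneg hq0]
    gcongr
    exact hsum w v
  have hpow : ‖x‖ ^ 4 ≤ (1 + ‖x‖) ^ 5 :=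
    (pow_le_pow_left₀ hx0 hx1 4).trans (pow_le_pow_right₀ h1le (by norm_num))
  calc |6 * M * (∑ i, 2 * x i * w i) * (∑ i, 2 * x i * v i) + 3 * M ^ 2 * ∑ i, 2 * w i * v i|
      ≤ |6 * M * (∑ i, 2 * x i * w i) * (∑ i, 2 * x i * v i)| + |3 * M ^ 2 * ∑ i, 2 * w i * v i| :=
        abs_add_le _ _
    _ ≤ 6 * (m * ‖x‖ ^ 2) * (2 * (m * ‖x‖ * ‖w‖)) * (2 * (m * ‖x‖ * ‖v‖)) +
          3 * (m * ‖x‖ ^ 2) ^ 2 * (2 * (m * ‖w‖ * ‖v‖)) := add_le_add b1 b2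
    _ = 30 * (m : ℝ) ^ 3 * ‖x‖ ^ 4 * ‖v‖ * ‖w‖ := by ring
    _ ≤ 30 * (m : ℝ) ^ 3 * (1 + ‖x‖) ^ 5 * ‖v‖ * ‖w‖ := by gcongr

/-- **The Hessian of `ψ_S` is positive semidefinite**, and bounded below by `6 q₊(x)² ‖v‖²`:
`D²ψ_S(x)(v,v) ≥ 6 q₊(x)² ‖v‖²`. [folklore] -/
theorem fderiv_fderiv_psi_self_ge (x v : Fin m → ℝ) :
    6 * max ((∑ i, x i ^ 2) - S ^ 2) 0 ^ 2 * ‖v‖ ^ 2 ≤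
      fderiv ℝ (fun x : Fin m → ℝ =>
        fderiv ℝ (fun x : Fin m → ℝ => max ((∑ i, x i ^ 2) - S ^ 2) 0 ^ 3) x v) x v := by
  rw [fderiv_fderiv_psi_apply]
  have hq0 : 0 ≤ max ((∑ i, x i ^ 2) - S ^ 2) 0 := le_max_right _ _
  have h1 : 0 ≤ 6 * max ((∑ i, x i ^ 2) - S ^ 2) 0 * (∑ i, 2 * x i * v i) * (∑ i, 2 * x i * v i) := by
    have e : 6 * max ((∑ i, x i ^ 2) - S ^ 2) 0 * (∑ i, 2 * x i * v i) * (∑ i, 2 * x i * v i) =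
        6 * max ((∑ i, x i ^ 2) - S ^ 2) 0 * ((∑ i, 2 * x i * v i) * (∑ i, 2 * x i * v i)) := by ring
    rw [e]
    exact mul_nonneg (by positivity) (mul_self_nonneg _)
  have h2 : ∑ i, 2 * v i * v i = 2 * ∑ i, v i ^ 2 := by
    rw [mul_sum]; exact sum_congr rfl fun i _ => by ring
  have h3 := norm_sq_le_sum_sq v
  rw [h2]
  nlinarith [pow_nonneg hq0 2]

/-- Where `‖x‖_∞ ≥ S + 1` (and `S ≥ 0`): `q(x) ≥ 2S + 1`. [folklore] -/
theorem quad_ge (hS : 0 ≤ S) {x : Fin m → ℝ} (hx : S + 1 ≤ ‖x‖) :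
    2 * S + 1 ≤ (∑ i, x i ^ 2) - S ^ 2 := by
  have h1 := norm_sq_le_sum_sq x
  have h2 : (S + 1) ^ 2 ≤ ‖x‖ ^ 2 := pow_le_pow_left₀ (by linarith) hx 2
  nlinarith

/-- **Strong convexity of `ψ_S` outside the cube of radius `S+1`**:
`D²ψ_S(x)(v,v) ≥ 6(2S+1)² ‖v‖²` for `‖x‖_∞ ≥ S + 1`. [folklore] -/
theorem fderiv_fderiv_psi_self_ge_of_norm (hS : 0 ≤ S) {x : Fin m → ℝ} (hx : S + 1 ≤ ‖x‖)
    (v : Fin m → ℝ) :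
    6 * (2 * S + 1) ^ 2 * ‖v‖ ^ 2 ≤
      fderiv ℝ (fun x : Fin m → ℝ =>
        fderiv ℝ (fun x : Fin m → ℝ => max ((∑ i, x i ^ 2) - S ^ 2) 0 ^ 3) x v) x v := by
  refine le_trans ?_ (fderiv_fderiv_psi_self_ge S x v)
  have hq := quad_ge S hS hx
  have : 2 * S + 1 ≤ max ((∑ i, x i ^ 2) - S ^ 2) 0 := hq.trans (le_max_left _ _)
  have h0 : 0 ≤ 2 * S + 1 := by linarith
  gcongr

/-- **Linear growth of `ψ_S`**: `ψ_S(x) ≥ ‖x‖_∞ - (S² + S + 1)`. [folklore] -/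
theorem psi_ge (hS : 0 ≤ S) (x : Fin m → ℝ) :
    ‖x‖ - (S ^ 2 + S + 1) ≤ max ((∑ i, x i ^ 2) - S ^ 2) 0 ^ 3 := by
  have h0 : 0 ≤ max ((∑ i, x i ^ 2) - S ^ 2) 0 := le_max_right _ _
  by_cases hx : ‖x‖ ≤ S + 1
  · nlinarith [pow_nonneg h0 3, sq_nonneg S]
  push Not at hx
  have hq := quad_ge S hS hx.le
  set t := (∑ i, x i ^ 2) - S ^ 2 with ht
  have ht1 : 1 ≤ t := by linarith
  have hmax : max t 0 = t := max_eq_left (by linarith)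
  rw [hmax]
  have hx1 : 1 ≤ ‖x‖ := by linarith
  have h1 : t ≤ t ^ 3 := by
    have ht0 : 0 ≤ t := by linarith
    have h2 : 1 ≤ t ^ 2 := by nlinarith
    calc t = t * 1 := (mul_one t).symm
      _ ≤ t * t ^ 2 := mul_le_mul_of_nonneg_left h2 ht0
      _ = t ^ 3 := by ring
  have h2 : ‖x‖ ^ 2 - S ^ 2 ≤ t := by have := norm_sq_le_sum_sq x; linarith
  have h3 : ‖x‖ ≤ ‖x‖ ^ 2 := by nlinarith
  nlinarith

/-- `ψ_S ≥ 0`. [folklore] -/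
theorem psi_nonneg (x : Fin m → ℝ) : 0 ≤ max ((∑ i, x i ^ 2) - S ^ 2) 0 ^ 3 :=
  pow_nonneg (le_max_right _ _) 3

/-- On the Euclidean ball `{∑ xᵢ² ≤ S²}`: `ψ_S = 0`. [folklore] -/
theorem psi_eq_zero {x : Fin m → ℝ} (hx : (∑ i, x i ^ 2) ≤ S ^ 2) :
    max ((∑ i, x i ^ 2) - S ^ 2) 0 ^ 3 = 0 := by
  rw [max_eq_right (by linarith), zero_pow three_ne_zero]

/-- Off the Euclidean ball: `ψ_S > 0`. [folklore] -/
theorem psi_pos {x : Fin m → ℝ} (hx : S ^ 2 < ∑ i, x i ^ 2) :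
    0 < max ((∑ i, x i ^ 2) - S ^ 2) 0 ^ 3 :=
  pow_pos (lt_max_of_lt_left (by linarith)) 3

/-- On the Euclidean ball the Hessian matrix of `ψ_S` vanishes. [folklore] -/
theorem coordHessian_psi_eq_zero {x : Fin m → ℝ} (hx : (∑ i, x i ^ 2) ≤ S ^ 2) :
    coordHessian (fun x : Fin m → ℝ => max ((∑ i, x i ^ 2) - S ^ 2) 0 ^ 3) x = 0 := by
  ext i j
  simp only [coordHessian, Matrix.of_apply, Matrix.zero_apply]
  rw [fderiv_fderiv_psi_apply, max_eq_right (by linarith)]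
  ring

/-- On the Euclidean ball the gradient of `ψ_S` vanishes. [folklore] -/
theorem fderiv_psi_eq_zero {x : Fin m → ℝ} (hx : (∑ i, x i ^ 2) ≤ S ^ 2) (v : Fin m → ℝ) :
    fderiv ℝ (fun x : Fin m → ℝ => max ((∑ i, x i ^ 2) - S ^ 2) 0 ^ 3) x v = 0 := by
  rw [fderiv_psi_apply, max_eq_right (by linarith)]
  ring

end Psi

end BrascampLiebCutoff

end Literature.Probability.Distributions
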